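import Mathlib.Data.Nat.Choose.Basic
import Mathlib.Algebra.BigOperators.Intervals
import Mathlib.Algebra.Order.BigOperators.Group.Finset
import Mathlib.Tactic
import Summits.CriticalPhenomena.PercolationContinuityZ3.Theorems.PercNearOneGluingNoHeavyLowerTailLemmaSNP
import Summits.CriticalPhenomena.PercolationContinuityZ3.Theorems.PercNearOneGluingNoHeavyLowerTailULCKappa
import Summits.CriticalPhenomena.PercolationContinuityZ3.Theorems.PercNearOneGluingNoHeavyLowerTailPairValues
import HarnessLib

/-!
# The one-block inequality: CONJECTURE U with one block tilted, for all parameters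

Support file for the Sahi / Conjecture-P programme of route `PercNearOneGluingNoHeavy`
(`--supports stmt-CriticalPhenomena-4575`, prover prim-l12-p5 gen 28; proof note
`prim-l12-p5/U-PROOF-g28.md` §4–§6).  No definitions, no named facts, no sorries.

* `total_two_block` : the untilted two-block total (from `ULCKappa.untilted_total` at `L = 0`);
* `one_block` (**(ONE) of the note, general tilt**) : for `2K + j = M + n` (`M, n ≥ 1`), `κ ≥ 0`,
  `κ N(N-1) ≥ M n (N - j²)` (`N = M + n`), and every symmetric unimodal `w ≥ 0` on the block of `M` coins
  (partner block of `n` coins untilted): `0 ≤ ∑_x C(M,x) w(x) C(n,K-x) (κ - (2x-M)(2x-M+j))` —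
  CONJECTURE U with one block untilted, in every regime.  Assembled from `LemmaSNP.lemma_S'` (windows and
  Abel summation under outward propagation of negativity) and `PairValues.negprop`.
-/

namespace Summit.CriticalPhenomena.PercolationContinuityZ3.Theorems

namespace OneBlock

open Finset

/-! ### The untilted total and the one-block inequality -/

/-- **Untilted two-block total** (`ULCKappa.untilted_total` at `L = 0`): for `M, n ≥ 1` and
`κ N(N-1) ≥ M n (N - (N-2K)²)` (`N = M + n`),
`0 ≤ ∑_x C(M,x) [x ≤ K] (κ C(n,K-x) + (2x-M)(2(K-x)-n) C(n,K-x))`. -/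
theorem total_two_block (M n K : ℕ) (hM : 1 ≤ M) (hn : 1 ≤ n) (κ : ℝ)
    (hκ' : (M : ℝ) * n * (((M : ℝ) + n) - (((M : ℝ) + n) - 2 * K) ^ 2) ≤
      κ * (((M : ℝ) + n) * (((M : ℝ) + n) - 1))) :
    0 ≤ ∑ x ∈ range (M + 1), (M.choose x : ℝ) *
        (if x ≤ K then κ * (n.choose (K - x) : ℝ) +
          (2 * (x : ℝ) - M) * ((n.choose (K - x) : ℝ) * (2 * ((K - x : ℕ) : ℝ) - n)) else 0) := by
  have htot := ULCKappa.untilted_total M n 0 K κ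
  rw [ULC.triple_comm, ULC.outer_form n M 0 K κ (fun _ => (1 : ℝ)) (fun _ => (1 : ℝ))] at htot
  -- closed forms of the inner sums
  have hin : ∀ x₁ ∈ range (M + 1), (M.choose x₁ : ℝ) * (fun _ : ℕ => (1 : ℝ)) x₁ *
      (if x₁ ≤ K then
        κ * (∑ x₂ ∈ range (n + 1), (n.choose x₂ : ℝ) *
            (if x₂ ≤ K - x₁ then ((0 : ℕ).choose (K - x₁ - x₂) : ℝ) else 0) * (fun _ : ℕ => (1 : ℝ)) x₂) +
        (2 * (x₁ : ℝ) - M) * (∑ x₂ ∈ range (n + 1), (n.choose x₂ : ℝ) *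
            (if x₂ ≤ K - x₁ then ((0 : ℕ).choose (K - x₁ - x₂) : ℝ) else 0) * (fun _ : ℕ => (1 : ℝ)) x₂ *
            (2 * (x₂ : ℝ) - n))
      else 0) =
      (M.choose x₁ : ℝ) *
        (if x₁ ≤ K then κ * (n.choose (K - x₁) : ℝ) +
          (2 * (x₁ : ℝ) - M) * ((n.choose (K - x₁) : ℝ) * (2 * ((K - x₁ : ℕ) : ℝ) - n)) else 0) := by
    intro x₁ _
    by_cases hx : x₁ ≤ K
    · rw [if_pos hx, if_pos hx]
      have hF := ULCKappa.F_one n 0 (K - x₁)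
      have hMo := ULCKappa.Mo_one n 0 (K - x₁)
      simp only [Nat.cast_zero, add_zero, sub_zero] at hF hMo ⊢
      rw [hF]
      have hnpos : (0 : ℝ) < n := by exact_mod_cast hn
      have hMo' : ∑ x ∈ range (n + 1), (n.choose x : ℝ) *
          (if x ≤ K - x₁ then ((0 : ℕ).choose (K - x₁ - x) : ℝ) else 0) * 1 * (2 * (x : ℝ) - n) =
          (2 * ((K - x₁ : ℕ) : ℝ) - n) * (n.choose (K - x₁) : ℝ) := by
        have e : (n : ℝ) * (∑ x ∈ range (n + 1), (n.choose x : ℝ) *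
            (if x ≤ K - x₁ then ((0 : ℕ).choose (K - x₁ - x) : ℝ) else 0) * 1 * (2 * (x : ℝ) - n)) =
            (n : ℝ) * ((2 * ((K - x₁ : ℕ) : ℝ) - n) * (n.choose (K - x₁) : ℝ)) := by
          rw [hMo]
          ring
        exact mul_left_cancel₀ hnpos.ne' e
      rw [hMo']
      ring
    · rw [if_neg hx, if_neg hx]
      simp
  rw [sum_congr rfl hin] at htot
  set S := ∑ x ∈ range (M + 1), (M.choose x : ℝ) *
        (if x ≤ K then κ * (n.choose (K - x) : ℝ) +
          (2 * (x : ℝ) - M) * ((n.choose (K - x) : ℝ) * (2 * ((K - x : ℕ) : ℝ) - n)) else 0) with hS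
  push_cast at htot
  simp only [add_zero] at htot
  have hM' : (1 : ℝ) ≤ M := by exact_mod_cast hM
  have hn' : (1 : ℝ) ≤ n := by exact_mod_cast hn
  have hNN : 0 < ((M : ℝ) + n) * (((M : ℝ) + n) - 1) := by nlinarith
  have hP : 0 < ((M : ℝ) + n) * (((M : ℝ) + n) - 1) * (n : ℝ) := by nlinarith
  have hR : 0 ≤ (n : ℝ) * (((M + n).choose K : ℕ) : ℝ) *
      (κ * (((M : ℝ) + n) * (((M : ℝ) + n) - 1)) + (M : ℝ) * n * ((((M : ℝ) + n) - 2 * K) ^ 2 - ((M : ℝ) + n))) := by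
    apply mul_nonneg (by positivity)
    linarith
  nlinarith [hP, hR, htot]

/-- **The one-block inequality (ONE) with a general tilt.**  For `2K + j = M + n` (`M, n ≥ 1`), `κ ≥ 0` with
`κ N(N-1) ≥ M n (N - j²)` (`N = M + n`; i.e. `κ ≥ κ₀ = M n (N-j²)₊/(N(N-1))`), and every symmetric unimodal
weight `w ≥ 0` on the head count `x` of the block of `M` coins, the partner block of `n` coins untilted:
`0 ≤ ∑_x C(M,x) w(x) C(n,K-x) (κ - (2x-M)(2x-M+j))` — written with `2(K-x)-n = -(2x-M+j)`.
This is CONJECTURE U with one of the two blocks untilted, for ALL `(M, n, j)`. -/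
theorem one_block (M n K j : ℕ) (hK : 2 * K + j = M + n) (hM : 1 ≤ M) (hn : 1 ≤ n) (κ : ℝ) (hκ : 0 ≤ κ)
    (hκ' : (M : ℝ) * n * (((M : ℝ) + n) - (j : ℝ) ^ 2) ≤ κ * (((M : ℝ) + n) * (((M : ℝ) + n) - 1)))
    (w : ℕ → ℝ) (hwnn : ∀ x, 0 ≤ w x) (hwsym : ∀ x, x ≤ M → w x = w (M - x))
    (hwuni : ∀ x, 2 * x + 2 ≤ M → w x ≤ w (x + 1)) :
    0 ≤ ∑ x ∈ range (M + 1), (M.choose x : ℝ) * w x *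
        (if x ≤ K then κ * (n.choose (K - x) : ℝ) +
          (2 * (x : ℝ) - M) * ((n.choose (K - x) : ℝ) * (2 * ((K - x : ℕ) : ℝ) - n)) else 0) := by
  have hj : ((M : ℝ) + n) - 2 * K = (j : ℝ) := by
    have : ((2 * K + j : ℕ) : ℝ) = ((M + n : ℕ) : ℝ) := by rw [hK]
    push_cast at this
    linarith
  have htot := total_two_block M n K hM hn κ (by rw [hj]; exact hκ')
  exact LemmaSNP.lemma_S' M K κ (fun k => (n.choose k : ℝ)) (fun k => (n.choose k : ℝ) * (2 * (k : ℝ) - n)) n j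
    (by omega) hκ
    (fun k hk => by simp [Nat.choose_eq_zero_of_lt hk])
    (fun k hk => by exact_mod_cast Nat.choose_pos hk)
    (fun k hk => by simp [Nat.choose_eq_zero_of_lt hk])
    (fun k hk => by simp [Nat.choose_symm hk])
    (fun k hk => by
      simp only [Nat.choose_symm hk]
      push_cast [Nat.cast_sub hk]
      ring)
    (PairValues.negprop M n j hM κ hκ hκ') htot w hwnn hwsym hwuni

end OneBlock

end Summit.CriticalPhenomena.PercolationContinuityZ3.Theorems
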